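import Summits.Parity.GeneralizedHardyLittlewood.Theorems.PrimeLevelFamEdgeMomentsBeyondDiagonalDiagRemBoseTwoSeq
import HarnessLib

/-!
# Route `PrimeLevelFamEdge`, crux K_A `MomentsBeyondDiagonal` (stmt-Parity-20007), line «petersson_layers» v4, stub `stub_diag`:
# **the continued Bose remainders `r₁₂, r₂₀, r₂₁, r₂₂` of ORDER `(2,2)` in `Π`-form — two-sequence Abel estimate** (brick B2b of (R₂₂))

Part of brick B2 of the order-`(2,2)` remainder estimate (plan: `Cruxes/MomentsBeyondDiagonal/Lines/petersson_layers_stub_diag_g12_R02_R22.md`):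
the general-`(a,b)` two-sequence estimate `…DiagRemBoseTwoSeq.abs_doubleSum_bose_rem_le₂` specialised to the four orders with
`a = 2` or `(a,b) = (1,2)`, the remainder written in `Π`-form with the moments `μ₂ = ∫₀¹log²v·v/(1+v²)²`, `μ₄ = ∫₀¹log⁴v·v/(1+v²)²`
EXPLICIT (so that this file combines with `…DiagRemBoseTwoSeq.abs_doubleSum_rem_le₂` / `…DiagRemZeroTwoBose` / a future B2a):
`Π₂₀ = L³/24 + 2μ₂L + E₂₀`, `Π₁₂ = Π₂₁-shape = −L⁴/64 + μ₂L²/2 + E`, `Π₂₂ = L⁵/160 − μ₂L³/3 + 2μ₄L + E₂₂` (`μ₀ = 1/4`; the odd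
moments cancel), and ONE common envelope `9C₀(1+|log 2αY²|)⁶`.

* `envelope_aux6`, `weaken_second_term6` — the envelope with exponent `6` (`a + b + 1 ≤ 5`);
* `abs_doubleSum_rem_le₂₂b` — **the four estimates with common constants `E₁₂, E₂₀, E₂₁, E₂₂, C₀`.**

Def-free; theorems only. Helper `--supports stmt-Parity-20007`; closes nothing; K_A, K_B and the Parity summit are NOT proved;
nothing about Landau–Siegel zeros.

## References
* E. Kowalski, P. Michel, J. VanderKam, J. reine angew. Math. 526 (2000), (22)–(28) pp. 12–15 and Prop. 5.1 p. 18.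
  [cite: KowalskiMichelVanderKam2000, Prop. 5.1 — derivation (corner of the diagonal, general Q, remainder weights, order (2,2))]
-/

noncomputable section

open Real MeasureTheory Finset

namespace Summit.Parity.GeneralizedHardyLittlewood.Theorems.MomentsBeyondDiagonal.DiagCorner

open Summit.Parity.GeneralizedHardyLittlewood.Theorems.BeyondDiagonalBeatsQuarter.Corner
open Summit.Parity.GeneralizedHardyLittlewood.Theorems.MomentsBeyondDiagonal.DiagLines

/-- `3(C₀ + C₀x^N) + 2C₀ + C₀x^N·x ≤ 9C₀x⁶` for `C₀ ≥ 0`, `x ≥ 1`, `N ≤ 5`. [folklore] -/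
theorem envelope_aux6 {C₀ x : ℝ} (hC : 0 ≤ C₀) (hx : 1 ≤ x) {N : ℕ} (hN : N ≤ 5) :
    3 * (C₀ + C₀ * x ^ N) + 2 * C₀ + C₀ * x ^ N * x ≤ 9 * C₀ * x ^ 6 := by
  have h4 : 1 ≤ x ^ 6 := one_le_pow₀ hx
  have hN4 : x ^ N ≤ x ^ 6 := pow_le_pow_right₀ hx (by omega)
  have hN1 : x ^ N * x ≤ x ^ 6 := by
    rw [← pow_succ]; exact pow_le_pow_right₀ hx (by omega)
  nlinarith [mul_le_mul_of_nonneg_left h4 hC, mul_le_mul_of_nonneg_left hN4 hC,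
    mul_le_mul_of_nonneg_left hN1 hC]

/-- Weakening of the second term of the two-sequence estimate to the common envelope `9C₀(1+|log(2αY²)|)⁶` (`N ≤ 5`). [folklore] -/
theorem weaken_second_term6 {S T Sj η L C₀ x : ℝ} {i N : ℕ} (hSj : 0 ≤ Sj) (hη : 0 ≤ η) (hL : 0 ≤ L)
    (hC : 0 ≤ C₀) (hx : 1 ≤ x) (hN : N ≤ 5)
    (h : S ≤ T + Sj * ((2 * η) * (L ^ i * (3 * (C₀ + C₀ * x ^ N) + 2 * C₀ + C₀ * x ^ N * x)))) :
    S ≤ T + Sj * ((2 * η) * (L ^ i * (9 * C₀ * x ^ 6))) := by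
  have hw := envelope_aux6 hC hx hN
  have : Sj * ((2 * η) * (L ^ i * (3 * (C₀ + C₀ * x ^ N) + 2 * C₀ + C₀ * x ^ N * x))) ≤
      Sj * ((2 * η) * (L ^ i * (9 * C₀ * x ^ 6))) := by
    have hLi : 0 ≤ L ^ i := pow_nonneg hL i
    gcongr
  linarith

/-- **THE CONTINUED BOSE REMAINDERS `r₁₂, r₂₀, r₂₁, r₂₂` IN `Π`-FORM (moments explicit), TWO-SEQUENCE ABEL ESTIMATE WITH A COMMON
ENVELOPE.** There are constants `E₁₂, E₂₀, E₂₁, E₂₂` and `C₀ ≥ 0` such that for all real sequences `a₁, a₂`, all `Y ≥ 1`, `α > 0`,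
`i, j ≥ 1`, `B, η, K₁` with `|Σ_{k≤e}a₂(k)| ≤ B` (`e ≤ ⌊Y⌋`), `|Σ_{k≤e}a₁(k)| ≤ η` (`e ≥ K₁`), `2αK₁Y ≤ 1`, each of the four sums
`Σ_{k₁,k₂≤Y} a₁(k₁)a₂(k₂)ℓ⁺(k₁)ⁱℓ⁺(k₂)ʲ·(c_ab(αk₁k₂) − Π_ab(log(1/(αk₁k₂))))`, `(a,b) ∈ {(1,2),(2,0),(2,1),(2,2)}`, is at most
`Sᵢ(a₁)·B·logʲY·3C₀√(2αK₁Y) + Sⱼ(a₂)·2η·logⁱY·9C₀(1+|log(2αY²)|)⁶`.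
[cite: KowalskiMichelVanderKam2000, (22)–(28) and Prop. 5.1 — derivation (corner of the diagonal, general Q, order (2,2))] -/
theorem abs_doubleSum_rem_le₂₂b : ∃ E₁₂ E₂₀ E₂₁ E₂₂ C₀ : ℝ, 0 ≤ C₀ ∧
    ∀ (a₁ a₂ : ℕ → ℝ) (Y α B η : ℝ) (K₁ i j : ℕ), 1 ≤ Y → 0 < α → 1 ≤ i → 1 ≤ j →
      (∀ e : ℕ, e ≤ ⌊Y⌋₊ → |∑ k ∈ Icc 1 e, a₂ k| ≤ B) → (∀ e : ℕ, K₁ ≤ e → |∑ k ∈ Icc 1 e, a₁ k| ≤ η) →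
      2 * α * K₁ * Y ≤ 1 →
    |∑ k₁ ∈ Icc 1 ⌊Y⌋₊, ∑ k₂ ∈ Icc 1 ⌊Y⌋₊,
        a₁ k₁ * a₂ k₂ * ellp Y k₁ ^ i * ellp Y k₂ ^ j *
          ((∫ u₁ in Set.Ioi (0 : ℝ), Real.log u₁ * ∫ u₂ in Set.Ioi ((α * k₁ * k₂) / u₁),
              Real.exp (-(u₁ + u₂)) / (1 - Real.exp (-(u₁ + u₂))) ^ 2 * Real.log u₂ ^ 2) -
            (-(Real.log (1 / (α * k₁ * k₂)) ^ 4) / 64 + (∫ v in Set.Ioc (0 : ℝ) 1, Real.log v ^ 2 * (v / (1 + v ^ 2) ^ 2)) * Real.log (1 / (α * k₁ * k₂)) ^ 2 / 2 + E₁₂))| ≤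
      (∑ k ∈ Icc 1 ⌊Y⌋₊, |a₁ k| * ellp Y k ^ i) * (B * (Real.log Y ^ j * (3 * C₀ * Real.sqrt (2 * α * K₁ * Y)))) +
        (∑ k ∈ Icc 1 ⌊Y⌋₊, |a₂ k| * ellp Y k ^ j) *
          ((2 * η) * (Real.log Y ^ i * (9 * C₀ * (1 + |Real.log (2 * α * Y ^ 2)|) ^ 6))) ∧
    |∑ k₁ ∈ Icc 1 ⌊Y⌋₊, ∑ k₂ ∈ Icc 1 ⌊Y⌋₊,
        a₁ k₁ * a₂ k₂ * ellp Y k₁ ^ i * ellp Y k₂ ^ j *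
          ((∫ u₁ in Set.Ioi (0 : ℝ), Real.log u₁ ^ 2 * ∫ u₂ in Set.Ioi ((α * k₁ * k₂) / u₁),
              Real.exp (-(u₁ + u₂)) / (1 - Real.exp (-(u₁ + u₂))) ^ 2) -
            (Real.log (1 / (α * k₁ * k₂)) ^ 3 / 24 + 2 * (∫ v in Set.Ioc (0 : ℝ) 1, Real.log v ^ 2 * (v / (1 + v ^ 2) ^ 2)) * Real.log (1 / (α * k₁ * k₂)) + E₂₀))| ≤
      (∑ k ∈ Icc 1 ⌊Y⌋₊, |a₁ k| * ellp Y k ^ i) * (B * (Real.log Y ^ j * (3 * C₀ * Real.sqrt (2 * α * K₁ * Y)))) +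
        (∑ k ∈ Icc 1 ⌊Y⌋₊, |a₂ k| * ellp Y k ^ j) *
          ((2 * η) * (Real.log Y ^ i * (9 * C₀ * (1 + |Real.log (2 * α * Y ^ 2)|) ^ 6))) ∧
    |∑ k₁ ∈ Icc 1 ⌊Y⌋₊, ∑ k₂ ∈ Icc 1 ⌊Y⌋₊,
        a₁ k₁ * a₂ k₂ * ellp Y k₁ ^ i * ellp Y k₂ ^ j *
          ((∫ u₁ in Set.Ioi (0 : ℝ), Real.log u₁ ^ 2 * ∫ u₂ in Set.Ioi ((α * k₁ * k₂) / u₁),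
              Real.exp (-(u₁ + u₂)) / (1 - Real.exp (-(u₁ + u₂))) ^ 2 * Real.log u₂) -
            (-(Real.log (1 / (α * k₁ * k₂)) ^ 4) / 64 + (∫ v in Set.Ioc (0 : ℝ) 1, Real.log v ^ 2 * (v / (1 + v ^ 2) ^ 2)) * Real.log (1 / (α * k₁ * k₂)) ^ 2 / 2 + E₂₁))| ≤
      (∑ k ∈ Icc 1 ⌊Y⌋₊, |a₁ k| * ellp Y k ^ i) * (B * (Real.log Y ^ j * (3 * C₀ * Real.sqrt (2 * α * K₁ * Y)))) +
        (∑ k ∈ Icc 1 ⌊Y⌋₊, |a₂ k| * ellp Y k ^ j) *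
          ((2 * η) * (Real.log Y ^ i * (9 * C₀ * (1 + |Real.log (2 * α * Y ^ 2)|) ^ 6))) ∧
    |∑ k₁ ∈ Icc 1 ⌊Y⌋₊, ∑ k₂ ∈ Icc 1 ⌊Y⌋₊,
        a₁ k₁ * a₂ k₂ * ellp Y k₁ ^ i * ellp Y k₂ ^ j *
          ((∫ u₁ in Set.Ioi (0 : ℝ), Real.log u₁ ^ 2 * ∫ u₂ in Set.Ioi ((α * k₁ * k₂) / u₁),
              Real.exp (-(u₁ + u₂)) / (1 - Real.exp (-(u₁ + u₂))) ^ 2 * Real.log u₂ ^ 2) -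
            (Real.log (1 / (α * k₁ * k₂)) ^ 5 / 160 - (∫ v in Set.Ioc (0 : ℝ) 1, Real.log v ^ 2 * (v / (1 + v ^ 2) ^ 2)) * Real.log (1 / (α * k₁ * k₂)) ^ 3 / 3 + 2 * (∫ v in Set.Ioc (0 : ℝ) 1, Real.log v ^ 4 * (v / (1 + v ^ 2) ^ 2)) * Real.log (1 / (α * k₁ * k₂)) + E₂₂))| ≤
      (∑ k ∈ Icc 1 ⌊Y⌋₊, |a₁ k| * ellp Y k ^ i) * (B * (Real.log Y ^ j * (3 * C₀ * Real.sqrt (2 * α * K₁ * Y)))) +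
        (∑ k ∈ Icc 1 ⌊Y⌋₊, |a₂ k| * ellp Y k ^ j) *
          ((2 * η) * (Real.log Y ^ i * (9 * C₀ * (1 + |Real.log (2 * α * Y ^ 2)|) ^ 6))) := by
  obtain ⟨C₁₂, hC₁₂, h₁₂⟩ := abs_doubleSum_bose_rem_le₂ 1 2
  obtain ⟨C₂₀, hC₂₀, h₂₀⟩ := abs_doubleSum_bose_rem_le₂ 2 0
  obtain ⟨C₂₁, hC₂₁, h₂₁⟩ := abs_doubleSum_bose_rem_le₂ 2 1
  obtain ⟨C₂₂, hC₂₂, h₂₂⟩ := abs_doubleSum_bose_rem_le₂ 2 2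
  set C₀ : ℝ := max (max C₁₂ C₂₀) (max C₂₁ C₂₂) with hC₀
  have e₁₂ : C₁₂ ≤ C₀ := (le_max_left _ _).trans (le_max_left _ _)
  have e₂₀ : C₂₀ ≤ C₀ := (le_max_right _ _).trans (le_max_left _ _)
  have e₂₁ : C₂₁ ≤ C₀ := (le_max_left _ _).trans (le_max_right _ _)
  have e₂₂ : C₂₂ ≤ C₀ := (le_max_right _ _).trans (le_max_right _ _)
  have hC₀0 : 0 ≤ C₀ := hC₁₂.trans e₁₂
  refine ⟨(∫ u₁ in Set.Ioi (0 : ℝ), Real.log u₁ ^ 1 * ∫ u₂ in Set.Ioi (1 / u₁),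
        Real.exp (-(u₁ + u₂)) / (1 - Real.exp (-(u₁ + u₂))) ^ 2 * Real.log u₂ ^ 2) +
      (∫ η in Set.Ioc (0 : ℝ) 1, (η * (∫ u in Set.Ioi (0 : ℝ), Real.log u ^ 1 * Real.log (η / u) ^ 2 *
            (Real.exp (-(u + η / u)) / (1 - Real.exp (-(u + η / u))) ^ 2) / u) -
          ∫ v in Set.Ioc (0 : ℝ) 1, ((-(Real.log (1 / η) / 2) + Real.log v) ^ 1 * (-(Real.log (1 / η) / 2) - Real.log v) ^ 2 +
              (-(Real.log (1 / η) / 2) - Real.log v) ^ 1 * (-(Real.log (1 / η) / 2) + Real.log v) ^ 2) *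
            (v / (1 + v ^ 2) ^ 2)) / η),
    (∫ u₁ in Set.Ioi (0 : ℝ), Real.log u₁ ^ 2 * ∫ u₂ in Set.Ioi (1 / u₁),
        Real.exp (-(u₁ + u₂)) / (1 - Real.exp (-(u₁ + u₂))) ^ 2 * Real.log u₂ ^ 0) +
      (∫ η in Set.Ioc (0 : ℝ) 1, (η * (∫ u in Set.Ioi (0 : ℝ), Real.log u ^ 2 * Real.log (η / u) ^ 0 *
            (Real.exp (-(u + η / u)) / (1 - Real.exp (-(u + η / u))) ^ 2) / u) -
          ∫ v in Set.Ioc (0 : ℝ) 1, ((-(Real.log (1 / η) / 2) + Real.log v) ^ 2 * (-(Real.log (1 / η) / 2) - Real.log v) ^ 0 +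
              (-(Real.log (1 / η) / 2) - Real.log v) ^ 2 * (-(Real.log (1 / η) / 2) + Real.log v) ^ 0) *
            (v / (1 + v ^ 2) ^ 2)) / η),
    (∫ u₁ in Set.Ioi (0 : ℝ), Real.log u₁ ^ 2 * ∫ u₂ in Set.Ioi (1 / u₁),
        Real.exp (-(u₁ + u₂)) / (1 - Real.exp (-(u₁ + u₂))) ^ 2 * Real.log u₂ ^ 1) +
      (∫ η in Set.Ioc (0 : ℝ) 1, (η * (∫ u in Set.Ioi (0 : ℝ), Real.log u ^ 2 * Real.log (η / u) ^ 1 *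
            (Real.exp (-(u + η / u)) / (1 - Real.exp (-(u + η / u))) ^ 2) / u) -
          ∫ v in Set.Ioc (0 : ℝ) 1, ((-(Real.log (1 / η) / 2) + Real.log v) ^ 2 * (-(Real.log (1 / η) / 2) - Real.log v) ^ 1 +
              (-(Real.log (1 / η) / 2) - Real.log v) ^ 2 * (-(Real.log (1 / η) / 2) + Real.log v) ^ 1) *
            (v / (1 + v ^ 2) ^ 2)) / η),
    (∫ u₁ in Set.Ioi (0 : ℝ), Real.log u₁ ^ 2 * ∫ u₂ in Set.Ioi (1 / u₁),
        Real.exp (-(u₁ + u₂)) / (1 - Real.exp (-(u₁ + u₂))) ^ 2 * Real.log u₂ ^ 2) +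
      (∫ η in Set.Ioc (0 : ℝ) 1, (η * (∫ u in Set.Ioi (0 : ℝ), Real.log u ^ 2 * Real.log (η / u) ^ 2 *
            (Real.exp (-(u + η / u)) / (1 - Real.exp (-(u + η / u))) ^ 2) / u) -
          ∫ v in Set.Ioc (0 : ℝ) 1, ((-(Real.log (1 / η) / 2) + Real.log v) ^ 2 * (-(Real.log (1 / η) / 2) - Real.log v) ^ 2 +
              (-(Real.log (1 / η) / 2) - Real.log v) ^ 2 * (-(Real.log (1 / η) / 2) + Real.log v) ^ 2) *
            (v / (1 + v ^ 2) ^ 2)) / η),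
    C₀, hC₀0, fun a₁ a₂ Y α B η K₁ i j hY hα hi hj hB hη hY₁ ↦ ?_⟩
  have hY0 : 0 < Y := by linarith
  have hη0 : 0 ≤ η := (abs_nonneg _).trans (hη K₁ le_rfl)
  have hLY : 0 ≤ Real.log Y := Real.log_nonneg hY
  have hx : (1 : ℝ) ≤ 1 + |Real.log (2 * α * Y ^ 2)| := by linarith [abs_nonneg (Real.log (2 * α * Y ^ 2))]
  have hSj : 0 ≤ ∑ k ∈ Icc 1 ⌊Y⌋₊, |a₂ k| * ellp Y k ^ j :=
    Finset.sum_nonneg fun k _ ↦ mul_nonneg (abs_nonneg _) (pow_nonneg (ellp_nonneg Y k) j)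
  have hSi : 0 ≤ ∑ k ∈ Icc 1 ⌊Y⌋₊, |a₁ k| * ellp Y k ^ i :=
    Finset.sum_nonneg fun k _ ↦ mul_nonneg (abs_nonneg _) (pow_nonneg (ellp_nonneg Y k) i)
  have hB0 : 0 ≤ B := (abs_nonneg _).trans (hB 0 (Nat.zero_le _))
  have hsq : 0 ≤ Real.sqrt (2 * α * K₁ * Y) := Real.sqrt_nonneg _
  have hfirst : ∀ {C : ℝ}, C ≤ C₀ →
      (∑ k ∈ Icc 1 ⌊Y⌋₊, |a₁ k| * ellp Y k ^ i) * (B * (Real.log Y ^ j * (3 * C * Real.sqrt (2 * α * K₁ * Y)))) ≤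
      (∑ k ∈ Icc 1 ⌊Y⌋₊, |a₁ k| * ellp Y k ^ i) * (B * (Real.log Y ^ j * (3 * C₀ * Real.sqrt (2 * α * K₁ * Y)))) := by
    intro C hC
    have hLj : 0 ≤ Real.log Y ^ j := pow_nonneg hLY j
    gcongr
  have hsecond : ∀ {C : ℝ} {N : ℕ}, 0 ≤ C → C ≤ C₀ →
      (∑ k ∈ Icc 1 ⌊Y⌋₊, |a₂ k| * ellp Y k ^ j) * ((2 * η) * (Real.log Y ^ i *
          (3 * (C + C * (1 + |Real.log (2 * α * Y ^ 2)|) ^ N) + 2 * C +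
            C * (1 + |Real.log (2 * α * Y ^ 2)|) ^ N * (1 + |Real.log (2 * α * Y ^ 2)|)))) ≤
      (∑ k ∈ Icc 1 ⌊Y⌋₊, |a₂ k| * ellp Y k ^ j) * ((2 * η) * (Real.log Y ^ i *
          (3 * (C₀ + C₀ * (1 + |Real.log (2 * α * Y ^ 2)|) ^ N) + 2 * C₀ +
            C₀ * (1 + |Real.log (2 * α * Y ^ 2)|) ^ N * (1 + |Real.log (2 * α * Y ^ 2)|)))) := by
    intro C N hC hCC
    have hLi : 0 ≤ Real.log Y ^ i := pow_nonneg hLY i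
    have hxN : 0 ≤ (1 + |Real.log (2 * α * Y ^ 2)|) ^ N := pow_nonneg (by positivity) N
    gcongr
  refine ⟨?_, ?_, ?_, ?_⟩
  · have h := h₁₂ a₁ a₂ Y α B η K₁ i j hY hα hi hj hB hη hY₁
    have h' := le_trans h (add_le_add (hfirst e₁₂) (hsecond hC₁₂ e₁₂))
    have h'' := weaken_second_term6 hSj hη0 hLY hC₀0 hx (by norm_num : 1 + 2 + 1 ≤ 5) h'
    refine le_trans (le_of_eq ?_) h''
    congr 1
    refine Finset.sum_congr rfl fun k₁ _ ↦ Finset.sum_congr rfl fun k₂ _ ↦ ?_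
    simp only [Finset.sum_range_succ, Finset.sum_range_zero, zero_add, add_zero, Nat.choose_self,
      Nat.choose_zero_right, Nat.choose_one_right, Nat.cast_one, Nat.cast_ofNat, Nat.sub_self, Nat.sub_zero,
      Nat.reduceSub, Nat.reduceAdd, Nat.cast_zero, Nat.cast_add, pow_zero, pow_one, one_mul, mul_one,
      integral_model_weight_Ioc]
    ring
  · have h := h₂₀ a₁ a₂ Y α B η K₁ i j hY hα hi hj hB hη hY₁
    have h' := le_trans h (add_le_add (hfirst e₂₀) (hsecond hC₂₀ e₂₀))
    have h'' := weaken_second_term6 hSj hη0 hLY hC₀0 hx (by norm_num : 2 + 0 + 1 ≤ 5) h'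
    refine le_trans (le_of_eq ?_) h''
    congr 1
    refine Finset.sum_congr rfl fun k₁ _ ↦ Finset.sum_congr rfl fun k₂ _ ↦ ?_
    simp only [Finset.sum_range_succ, Finset.sum_range_zero, zero_add, add_zero, Nat.choose_self,
      Nat.choose_zero_right, Nat.choose_one_right, Nat.cast_one, Nat.cast_ofNat, Nat.sub_self, Nat.sub_zero,
      Nat.reduceSub, Nat.reduceAdd, Nat.cast_zero, Nat.cast_add, pow_zero, pow_one, one_mul, mul_one,
      integral_model_weight_Ioc]
    ring
  · have h := h₂₁ a₁ a₂ Y α B η K₁ i j hY hα hi hj hB hη hY₁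
    have h' := le_trans h (add_le_add (hfirst e₂₁) (hsecond hC₂₁ e₂₁))
    have h'' := weaken_second_term6 hSj hη0 hLY hC₀0 hx (by norm_num : 2 + 1 + 1 ≤ 5) h'
    refine le_trans (le_of_eq ?_) h''
    congr 1
    refine Finset.sum_congr rfl fun k₁ _ ↦ Finset.sum_congr rfl fun k₂ _ ↦ ?_
    simp only [Finset.sum_range_succ, Finset.sum_range_zero, zero_add, add_zero, Nat.choose_self,
      Nat.choose_zero_right, Nat.choose_one_right, Nat.cast_one, Nat.cast_ofNat, Nat.sub_self, Nat.sub_zero,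
      Nat.reduceSub, Nat.reduceAdd, Nat.cast_zero, Nat.cast_add, pow_zero, pow_one, one_mul, mul_one,
      integral_model_weight_Ioc]
    ring
  · have h := h₂₂ a₁ a₂ Y α B η K₁ i j hY hα hi hj hB hη hY₁
    have h' := le_trans h (add_le_add (hfirst e₂₂) (hsecond hC₂₂ e₂₂))
    have h'' := weaken_second_term6 hSj hη0 hLY hC₀0 hx (by norm_num : 2 + 2 + 1 ≤ 5) h'
    refine le_trans (le_of_eq ?_) h''
    congr 1
    refine Finset.sum_congr rfl fun k₁ _ ↦ Finset.sum_congr rfl fun k₂ _ ↦ ?_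
    simp only [Finset.sum_range_succ, Finset.sum_range_zero, zero_add, add_zero, Nat.choose_self,
      Nat.choose_zero_right, Nat.choose_one_right, Nat.cast_one, Nat.cast_ofNat, Nat.sub_self, Nat.sub_zero,
      Nat.reduceSub, Nat.reduceAdd, Nat.cast_zero, Nat.cast_add, pow_zero, pow_one, one_mul, mul_one,
      integral_model_weight_Ioc]
    ring

end Summit.Parity.GeneralizedHardyLittlewood.Theorems.MomentsBeyondDiagonal.DiagCorner

end
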